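import Summits.CriticalPhenomena.PercolationContinuityZ3.Theorems.PercNearOneGluingNoHeavyLowerTailTformGluedStarPackingRef
import Summits.CriticalPhenomena.PercolationContinuityZ3.Theorems.PercNearOneGluingNoHeavyLowerTailTformGluingResidual
import HarnessLib

/-!
# `NoHeavyLowerTail` (stmt-CriticalPhenomena-4575) — the crux from the two-event champion comparison REF3

Support file (prover `prim-hp-5`, hull-port cell, T-form calculus, gen 7; `--supports stmt-CriticalPhenomena-4575`).  No definitions,
no named facts, no sorries.  Setting of the informative gluing step (`Theorems.noHeavyLowerTail_of_informativeGluedChampion`):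
champion `q`, fallback `c`, light non-relay set `B` (`2 ≤ |B|`), the set-induction hypothesis, a member `y ∈ B` with a positive pair,
`u` = `w` without the pairs at `y`, `p` a champion of `u`, and `G_x` = "`x` light in `w/B`".  Let `D` be any set of relays `r` that
`q` dominates in `u` (`Φ_u(r) ≤ Φ_u(q)`) and `C_D = {all pairs y–r, r ∈ D, closed}`.  On a star `S` of `y` meeting `D` the witness `q`
itself is a T-witness of the glued star `(B ∖ y) ∪ S` in `u` (unguarded stability through the dominated relay); on the other stars the
sub-champion `p` is (induction hypothesis).  The glued star packing with these starwise references (`Theorems.gluedSet_lsp_of_starwise`)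
therefore gives LSP(w, q, c, B) as soon as
    REF3(y, p, D):   `μ(C_D ∩ G_p) ≤ μ(C_D ∩ G_q)`     (for `D = ∅`: `μ(G_p) ≤ μ(G_q)`, the sub-champion comparison).
Seat census (memo OBSERVER-SET.md §20, lab y32/y33): with `D` = all dominated relay neighbours of `y`, REF3 holds for SOME member `y` in
every informative instance tested (0 / 3,139; the single-reference forms CLAIM Y / champion persistence are false).

* `star_lsp_of_dominatedRelay` — a relay dominating a relay member of a set is a T-witness of the glued set (any fallback);
* `gluedSet_lsp_of_ref3` — LSP(w, q, c, B) from REF3(y, p, D);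
* `noHeavyLowerTail_of_ref3Certificate` — the crux from REF3 at every informative instance (∃ y, p, D).
-/

noncomputable section

namespace Summit.CriticalPhenomena.PercolationContinuityZ3.Theorems

open MeasureTheory Set Literature.Probability.LatticeModels Literature.Probability.Percolation
open scoped Classical BigOperators

variable {n : ℕ}

open CutObserver in
/-- **A relay dominating a relay member is a T-witness of the glued set.**  For any weights `u`, a vertex set `S'` containing a relay `r`,
and a relay `x ≠ r` with `μ(|π(r)| ≤ j) ≤ μ(|π(x)| ≤ j)`: `μ(x ≁ S', 1 ≤ |π(S')| ≤ j) + μ(|π(S')| = 0, |π(c)| ≤ j) ≤ μ(x ≁ S', |π(x)| ≤ j)`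
(the second event is empty since `r ∈ S'` is a relay; the rest is `CutObserver.unguardedStability_of_member`).
[cite: VandenbergHaggstromKahn2005, Thm. 1.5 (p. 7) — corollary] -/
theorem star_lsp_of_dominatedRelay (u : Sym2 (Fin n) → unitInterval) (A S' : Finset (Fin n)) (x r c : Fin n) (j : ℕ)
    (hrA : r ∈ A) (hrS : r ∈ S') (hxr : x ≠ r)
    (hle : (prodBernoulli u).real {ξ : BondConfig (Fin n) | (A.filter fun z => (openGraph ξ).Reachable r z).card ≤ j} ≤
      (prodBernoulli u).real {ξ : BondConfig (Fin n) | (A.filter fun z => (openGraph ξ).Reachable x z).card ≤ j}) :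
    (prodBernoulli u).real {ξ : BondConfig (Fin n) | (∀ m ∈ S', ¬ (openGraph ξ).Reachable x m) ∧
        1 ≤ (A.filter fun z => ∃ m ∈ S', (openGraph ξ).Reachable m z).card ∧ (A.filter fun z => ∃ m ∈ S', (openGraph ξ).Reachable m z).card ≤ j} +
      (prodBernoulli u).real {ξ : BondConfig (Fin n) | ¬ 1 ≤ (A.filter fun z => ∃ m ∈ S', (openGraph ξ).Reachable m z).card ∧
        (A.filter fun z => (openGraph ξ).Reachable c z).card ≤ j} ≤
      (prodBernoulli u).real {ξ : BondConfig (Fin n) | (∀ m ∈ S', ¬ (openGraph ξ).Reachable x m) ∧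
        (A.filter fun z => (openGraph ξ).Reachable x z).card ≤ j} := by
  haveI : IsProbabilityMeasure (prodBernoulli u) := inferInstance
  set ν := prodBernoulli u with hν
  set MS : BondConfig (Fin n) → ℕ := fun ξ => (A.filter fun z => ∃ m ∈ S', (openGraph ξ).Reachable m z).card with hMS
  have hMS1 : ∀ ξ, 1 ≤ MS ξ := fun ξ =>
    Finset.card_pos.2 ⟨r, Finset.mem_filter.2 ⟨hrA, r, hrS, SimpleGraph.Reachable.refl r⟩⟩
  have h2 : ν.real {ξ : BondConfig (Fin n) | ¬ 1 ≤ MS ξ ∧ (A.filter fun z => (openGraph ξ).Reachable c z).card ≤ j} = 0 := by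
    have : {ξ : BondConfig (Fin n) | ¬ 1 ≤ MS ξ ∧ (A.filter fun z => (openGraph ξ).Reachable c z).card ≤ j} = (∅ : Set (BondConfig (Fin n))) := by
      ext ξ; simp only [mem_setOf_eq, mem_empty_iff_false, iff_false, not_and]
      intro h; exact absurd (hMS1 ξ) h
    rw [this, measureReal_empty]
  have key := unguardedStability_of_member u A S' hrS hxr j hle
  change ν.real {ξ | (∀ m ∈ S', ¬ (openGraph ξ).Reachable x m) ∧ MS ξ ≤ j} ≤
    ν.real {ξ | (∀ m ∈ S', ¬ (openGraph ξ).Reachable x m) ∧ (A.filter fun z => (openGraph ξ).Reachable x z).card ≤ j} at key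
  change ν.real {ξ | (∀ m ∈ S', ¬ (openGraph ξ).Reachable x m) ∧ 1 ≤ MS ξ ∧ MS ξ ≤ j} +
    ν.real {ξ : BondConfig (Fin n) | ¬ 1 ≤ MS ξ ∧ (A.filter fun z => (openGraph ξ).Reachable c z).card ≤ j} ≤ _
  rw [h2, add_zero]
  refine le_trans (measureReal_mono (fun ξ hξ => ?_) (measure_ne_top _ _)) key
  exact ⟨hξ.1, hξ.2.2⟩

open CutObserver KNPreFKG in
/-- **The gluing step from the two-event comparison REF3.**  With the set-induction hypothesis, a member `y ∈ B` with a positive pair,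
`p` a champion of `u` (= `w` without the pairs at `y`), and a set `D` of relays dominated by `q` in `u`: if `μ(C_D ∩ G_p) ≤ μ(C_D ∩ G_q)`
(`C_D` = all pairs `y–r`, `r ∈ D`, closed; `G_x` = "`x` light in `w/B`"), then LSP(w, q, c, B).
[cite: KozmaNitzan2024, Lemma 5 and Thm. 4 (pp. 13–14)] -/
theorem gluedSet_lsp_of_ref3 (w : Sym2 (Fin n) → unitInterval) (A B D : Finset (Fin n)) (y p q c : Fin n) (j : ℕ)
    (ih : ∀ (n' : ℕ) (w' : Sym2 (Fin n') → unitInterval) (A' B' : Finset (Fin n')) (q' c' : Fin n') (j' : ℕ),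
      (Finset.univ.filter fun e : Sym2 (Fin n') => w' e ≠ 0).card < (Finset.univ.filter fun e : Sym2 (Fin n) => w e ≠ 0).card →
      q' ∈ A' → c' ∈ A' → B'.Nonempty → (∀ m ∈ B', m ∉ A') →
      (∀ a ∈ A', (prodBernoulli w').real {ω : BondConfig (Fin n') | (A'.filter fun x => ω ∈ openConn a x).card ≤ j'} ≤
        (prodBernoulli w').real {ω : BondConfig (Fin n') | (A'.filter fun x => ω ∈ openConn q' x).card ≤ j'}) →
      (prodBernoulli w').real {ω : BondConfig (Fin n') | (∀ m ∈ B', ω ∉ openConn q' m) ∧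
          1 ≤ (A'.filter fun z => ∃ m ∈ B', ω ∈ openConn m z).card ∧ (A'.filter fun z => ∃ m ∈ B', ω ∈ openConn m z).card ≤ j'} +
        (prodBernoulli w').real {ω : BondConfig (Fin n') | ¬ 1 ≤ (A'.filter fun z => ∃ m ∈ B', ω ∈ openConn m z).card ∧
          (A'.filter fun z => ω ∈ openConn c' z).card ≤ j'} ≤
      (prodBernoulli w').real {ω : BondConfig (Fin n') | (∀ m ∈ B', ω ∉ openConn q' m) ∧ (A'.filter fun z => ω ∈ openConn q' z).card ≤ j'})
    (hqA : q ∈ A) (hcA : c ∈ A) (hBA : ∀ m ∈ B, m ∉ A) (hyB : y ∈ B) (hB2 : 2 ≤ B.card) (hy : ∃ v, v ≠ y ∧ w s(y, v) ≠ 0)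
    (hpA : p ∈ A)
    (hpch : ∀ a ∈ A, (prodBernoulli fun e => if e ∈ {e : Sym2 (Fin n) | y ∉ e} then w e else 0).real
        {ξ : BondConfig (Fin n) | (A.filter fun z => ξ ∈ openConn a z).card ≤ j} ≤
      (prodBernoulli fun e => if e ∈ {e : Sym2 (Fin n) | y ∉ e} then w e else 0).real
        {ξ : BondConfig (Fin n) | (A.filter fun z => ξ ∈ openConn p z).card ≤ j})
    (hD : ∀ r ∈ D, r ∈ A ∧ (prodBernoulli fun e => if e ∈ {e : Sym2 (Fin n) | y ∉ e} then w e else 0).real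
        {ξ : BondConfig (Fin n) | (A.filter fun z => ξ ∈ openConn r z).card ≤ j} ≤
      (prodBernoulli fun e => if e ∈ {e : Sym2 (Fin n) | y ∉ e} then w e else 0).real
        {ξ : BondConfig (Fin n) | (A.filter fun z => ξ ∈ openConn q z).card ≤ j})
    (hcmp : (prodBernoulli w).real ({ω : BondConfig (Fin n) | ∀ r ∈ D, s(y, r) ∉ ω} ∩ {ω : BondConfig (Fin n) |
        ((∃ m ∈ B, ω ∈ openConn p m) → (A.filter fun z => ∃ m ∈ B, ω ∈ openConn m z).card ≤ j) ∧
          ((∀ m ∈ B, ω ∉ openConn p m) → (A.filter fun z => ω ∈ openConn p z).card ≤ j)}) ≤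
      (prodBernoulli w).real ({ω : BondConfig (Fin n) | ∀ r ∈ D, s(y, r) ∉ ω} ∩ {ω : BondConfig (Fin n) |
        ((∃ m ∈ B, ω ∈ openConn q m) → (A.filter fun z => ∃ m ∈ B, ω ∈ openConn m z).card ≤ j) ∧
          ((∀ m ∈ B, ω ∉ openConn q m) → (A.filter fun z => ω ∈ openConn q z).card ≤ j)})) :
    (prodBernoulli w).real {ω : BondConfig (Fin n) | (∀ m ∈ B, ω ∉ openConn q m) ∧
        1 ≤ (A.filter fun z => ∃ m ∈ B, ω ∈ openConn m z).card ∧ (A.filter fun z => ∃ m ∈ B, ω ∈ openConn m z).card ≤ j} +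
      (prodBernoulli w).real {ω : BondConfig (Fin n) | ¬ 1 ≤ (A.filter fun z => ∃ m ∈ B, ω ∈ openConn m z).card ∧
        (A.filter fun z => ω ∈ openConn c z).card ≤ j} ≤
      (prodBernoulli w).real {ω : BondConfig (Fin n) | (∀ m ∈ B, ω ∉ openConn q m) ∧ (A.filter fun z => ω ∈ openConn q z).card ≤ j} := by
  haveI : IsProbabilityMeasure (prodBernoulli w) := inferInstance
  set μ := prodBernoulli w with hμ
  have hyA : y ∉ A := hBA y hyB
  set B' : Finset (Fin n) := B.erase y with hB'
  have hyB' : y ∉ B' := Finset.notMem_erase y B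
  have hBeq : insert y B' = B := Finset.insert_erase hyB
  have hB'ne : B'.Nonempty := by
    rw [← Finset.card_pos, hB', Finset.card_erase_of_mem hyB]; omega
  -- the weights without the pairs at `y` have fewer positive pairs
  set u : Sym2 (Fin n) → unitInterval := fun e => if e ∈ {e : Sym2 (Fin n) | y ∉ e} then w e else 0 with hu
  obtain ⟨v₀, hv₀y, hv₀⟩ := hy
  have hlt : (Finset.univ.filter fun e : Sym2 (Fin n) => u e ≠ 0).card <
      (Finset.univ.filter fun e : Sym2 (Fin n) => w e ≠ 0).card := by
    refine Finset.card_lt_card ⟨fun e he => ?_, fun hsub => ?_⟩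
    · rw [Finset.mem_filter] at he ⊢
      refine ⟨he.1, fun hwe => he.2 ?_⟩
      simp only [hu, mem_setOf_eq]
      split_ifs <;> simp [hwe]
    · have hmem : s(y, v₀) ∈ (Finset.univ.filter fun e : Sym2 (Fin n) => w e ≠ 0) :=
        Finset.mem_filter.2 ⟨Finset.mem_univ _, hv₀⟩
      have := Finset.mem_filter.1 (hsub hmem)
      apply this.2
      simp only [hu, mem_setOf_eq, Sym2.mem_iff, true_or, not_true_eq_false, if_false]
  set ν := prodBernoulli u with hν
  haveI : IsProbabilityMeasure ν := inferInstance
  have hfilt : ∀ (x : Fin n) (ξ : BondConfig (Fin n)),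
      (A.filter fun z => (openGraph ξ).Reachable x z) = (A.filter fun z => ξ ∈ openConn x z) :=
    fun x ξ => Finset.filter_congr fun _ _ => Iff.rfl
  have eoc : ∀ (x : Fin n), {ξ : BondConfig (Fin n) | (A.filter fun z => (openGraph ξ).Reachable x z).card ≤ j} =
      {ξ : BondConfig (Fin n) | (A.filter fun z => ξ ∈ openConn x z).card ≤ j} := by
    intro x; ext ξ
    exact ⟨fun h => by rw [mem_setOf_eq] at h ⊢; rwa [← hfilt x ξ], fun h => by rw [mem_setOf_eq] at h ⊢; rwa [hfilt x ξ]⟩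
  set sW : Fin n → ℝ := fun v => ν.real {ξ : BondConfig (Fin n) | (A.filter fun z => (openGraph ξ).Reachable v z).card ≤ j} with hsW
  have hpmax : ∀ a ∈ A, sW a ≤ sW p := by
    intro a ha; simp only [hsW]; rw [eoc a, eoc p]; exact hpch a ha
  have hDq : ∀ r ∈ D, sW r ≤ sW q := by
    intro r hr; simp only [hsW]; rw [eoc r, eoc q]; exact (hD r hr).2
  -- the starwise references: `q` on stars meeting `D`, `p` elsewhere
  set ref : Finset (Fin n) → Fin n := fun S => if (∃ r ∈ D, r ∈ S) then q else p with href
  have hrefA : ∀ S, ref S ∈ A := by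
    intro S; simp only [href]; split_ifs; exacts [hqA, hpA]
  -- gates of `y`, the glued-lightness events and the cylinder `C_D`
  set Γ : Finset (Fin n) := Finset.univ.filter fun v => v ≠ y ∧ w s(y, v) ≠ 0 with hΓ
  have hΓy : y ∉ Γ := by
    rw [hΓ, Finset.mem_filter]; exact fun h => h.2.1 rfl
  have hiso : ∀ v, v ≠ y → v ∉ Γ → w s(y, v) = 0 := by
    intro v hvy hvΓ
    by_contra hne
    exact hvΓ (Finset.mem_filter.2 ⟨Finset.mem_univ _, hvy, hne⟩)
  set G : Fin n → Set (BondConfig (Fin n)) := fun x => {ω : BondConfig (Fin n) |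
    ((∃ m ∈ B, ω ∈ openConn x m) → (A.filter fun z => ∃ m ∈ B, ω ∈ openConn m z).card ≤ j) ∧
      ((∀ m ∈ B, ω ∉ openConn x m) → (A.filter fun z => ω ∈ openConn x z).card ≤ j)} with hGdef
  set CD : Set (BondConfig (Fin n)) := {ω | ∀ r ∈ D, s(y, r) ∉ ω} with hCD
  change μ.real (CD ∩ G p) ≤ μ.real (CD ∩ G q) at hcmp
  -- on a star, `C_D` holds iff the star misses `D`
  have hCDstar : ∀ S ∈ Γ.powerset, ∀ E : Set (BondConfig (Fin n)),
      E ∩ CD ∩ starEvent y ↑S = if (∃ r ∈ D, r ∈ S) then (∅ : Set (BondConfig (Fin n))) else E ∩ starEvent y ↑S := by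
    intro S hS E
    split_ifs with h
    · obtain ⟨r, hrD, hrS⟩ := h
      have hry : r ≠ y := fun h' => hyA (h' ▸ (hD r hrD).1)
      ext ω
      constructor
      · rintro ⟨⟨_, hC⟩, hσ⟩
        exact (hC r hrD (((mem_starEvent_iff y (↑S) ω).1 hσ r hry).2 (Finset.mem_coe.2 hrS))).elim
      · intro h; exact absurd h (Set.notMem_empty ω)
    · push Not at h
      ext ω
      simp only [mem_inter_iff]
      constructor
      · rintro ⟨⟨hE, _⟩, hσ⟩; exact ⟨hE, hσ⟩
      · rintro ⟨hE, hσ⟩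
        refine ⟨⟨hE, fun r hrD hmem => ?_⟩, hσ⟩
        have hry : r ≠ y := fun h' => hyA (h' ▸ (hD r hrD).1)
        exact h r hrD (Finset.mem_coe.1 (((mem_starEvent_iff y (↑S) ω).1 hσ r hry).1 hmem))
  -- the starwise sum of glued lightness: Σ_S μ(G_{ref S} ∩ σ_S) = μ(G_q) − μ(C_D ∩ G_q) + μ(C_D ∩ G_p)
  have hterm : ∀ S ∈ Γ.powerset, μ.real (G (ref S) ∩ starEvent y ↑S) =
      μ.real (G q ∩ starEvent y ↑S) - μ.real (G q ∩ CD ∩ starEvent y ↑S) + μ.real (G p ∩ CD ∩ starEvent y ↑S) := by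
    intro S hS
    rw [hCDstar S hS (G q), hCDstar S hS (G p)]
    by_cases h : ∃ r ∈ D, r ∈ S
    · have : ref S = q := by simp only [href]; rw [if_pos h]
      rw [this, if_pos h, if_pos h, measureReal_empty]; ring
    · have : ref S = p := by simp only [href]; rw [if_neg h]
      rw [this, if_neg h, if_neg h]; ring
  have hsumq := real_eq_sum_inter_starEvent w Γ y hΓy hiso (G q)
  have hsumqC := real_eq_sum_inter_starEvent w Γ y hΓy hiso (G q ∩ CD)
  have hsumpC := real_eq_sum_inter_starEvent w Γ y hΓy hiso (G p ∩ CD)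
  have hsum : ∑ S ∈ Γ.powerset, μ.real (G (ref S) ∩ starEvent y ↑S) ≤ μ.real (G q) := by
    rw [Finset.sum_congr rfl hterm, Finset.sum_add_distrib, Finset.sum_sub_distrib, ← hsumq, ← hsumqC, ← hsumpC]
    have e1 : G q ∩ CD = CD ∩ G q := inter_comm _ _
    have e2 : G p ∩ CD = CD ∩ G p := inter_comm _ _
    rw [e1, e2]
    linarith
  -- ### the glued star packing with the starwise references
  rw [← hBeq]
  refine gluedSet_lsp_of_starwise w A B' y q c ref j hyA hrefA hqA hcA hyB' ?_ (by rw [hBeq]; exact hsum)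
  -- ### the packing inequality at every star
  intro S hS
  set S' : Finset (Fin n) := B' ∪ S with hS'
  set x : Fin n := ref S with hx
  have hxA : x ∈ A := hrefA S
  have eP1 : {ω : BondConfig (Fin n) | (∀ m ∈ S', ¬ (openGraph (ω ∩ {e | y ∉ e})).Reachable x m) ∧
        1 ≤ (A.filter fun z => ∃ m ∈ S', (openGraph (ω ∩ {e | y ∉ e})).Reachable m z).card ∧
        (A.filter fun z => ∃ m ∈ S', (openGraph (ω ∩ {e | y ∉ e})).Reachable m z).card ≤ j} =
      {ω : BondConfig (Fin n) | ω ∩ {e | y ∉ e} ∈ {ξ : BondConfig (Fin n) | (∀ m ∈ S', ¬ (openGraph ξ).Reachable x m) ∧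
        1 ≤ (A.filter fun z => ∃ m ∈ S', (openGraph ξ).Reachable m z).card ∧
        (A.filter fun z => ∃ m ∈ S', (openGraph ξ).Reachable m z).card ≤ j}} := rfl
  have eP2 : {ω : BondConfig (Fin n) | ¬ 1 ≤ (A.filter fun z => ∃ m ∈ S', (openGraph (ω ∩ {e | y ∉ e})).Reachable m z).card ∧
        (A.filter fun z => (openGraph (ω ∩ {e | y ∉ e})).Reachable c z).card ≤ j} =
      {ω : BondConfig (Fin n) | ω ∩ {e | y ∉ e} ∈ {ξ : BondConfig (Fin n) |
        ¬ 1 ≤ (A.filter fun z => ∃ m ∈ S', (openGraph ξ).Reachable m z).card ∧ (A.filter fun z => (openGraph ξ).Reachable c z).card ≤ j}} := rfl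
  have eP3 : {ω : BondConfig (Fin n) | (∀ m ∈ S', ¬ (openGraph (ω ∩ {e | y ∉ e})).Reachable x m) ∧
        (A.filter fun z => (openGraph (ω ∩ {e | y ∉ e})).Reachable x z).card ≤ j} =
      {ω : BondConfig (Fin n) | ω ∩ {e | y ∉ e} ∈ {ξ : BondConfig (Fin n) | (∀ m ∈ S', ¬ (openGraph ξ).Reachable x m) ∧
        (A.filter fun z => (openGraph ξ).Reachable x z).card ≤ j}} := rfl
  rw [eP1, eP2, eP3, measureReal_preimage_avoid, measureReal_preimage_avoid, measureReal_preimage_avoid]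
  set MS : BondConfig (Fin n) → ℕ := fun ξ => (A.filter fun z => ∃ m ∈ S', (openGraph ξ).Reachable m z).card with hMS
  set Lx : Fin n → BondConfig (Fin n) → ℕ := fun v ξ => (A.filter fun z => (openGraph ξ).Reachable v z).card with hLx
  change ν.real {ξ | (∀ m ∈ S', ¬ (openGraph ξ).Reachable x m) ∧ 1 ≤ MS ξ ∧ MS ξ ≤ j} + ν.real {ξ | ¬ 1 ≤ MS ξ ∧ Lx c ξ ≤ j} ≤
    ν.real {ξ | (∀ m ∈ S', ¬ (openGraph ξ).Reachable x m) ∧ Lx x ξ ≤ j}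
  have hMS0 : ∀ ξ, ¬ 1 ≤ MS ξ → ∀ m ∈ S', ¬ (openGraph ξ).Reachable x m := by
    intro ξ h m hm hxm
    exact h (Finset.card_pos.2 ⟨x, Finset.mem_filter.2 ⟨hxA, m, hm, hxm.symm⟩⟩)
  by_cases hmeet : ∃ r ∈ D, r ∈ S
  · -- #### a star meeting `D`: the reference is `q`, a T-witness through the dominated relay
    obtain ⟨r, hrD, hrS⟩ := hmeet
    have hxq : x = q := by simp only [hx, href]; rw [if_pos ⟨r, hrD, hrS⟩]
    have hrA : r ∈ A := (hD r hrD).1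
    have hrS' : r ∈ S' := Finset.mem_union_right _ hrS
    by_cases hqr : q = r
    · -- `q` itself is a member: everything vanishes
      have hqS' : x ∈ S' := by rw [hxq, hqr]; exact hrS'
      have h1 : ν.real {ξ | (∀ m ∈ S', ¬ (openGraph ξ).Reachable x m) ∧ 1 ≤ MS ξ ∧ MS ξ ≤ j} = 0 := by
        have : {ξ | (∀ m ∈ S', ¬ (openGraph ξ).Reachable x m) ∧ 1 ≤ MS ξ ∧ MS ξ ≤ j} = (∅ : Set (BondConfig (Fin n))) := by
          ext ξ; simp only [mem_setOf_eq, mem_empty_iff_false, iff_false, not_and]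
          intro h; exact absurd (SimpleGraph.Reachable.refl x) (h x hqS')
        rw [this, measureReal_empty]
      have h2 : ν.real {ξ | ¬ 1 ≤ MS ξ ∧ Lx c ξ ≤ j} = 0 := by
        have : {ξ | ¬ 1 ≤ MS ξ ∧ Lx c ξ ≤ j} = (∅ : Set (BondConfig (Fin n))) := by
          ext ξ; simp only [mem_setOf_eq, mem_empty_iff_false, iff_false, not_and]
          intro h; exact absurd (SimpleGraph.Reachable.refl x) (hMS0 ξ h x hqS')
        rw [this, measureReal_empty]
      rw [h1, h2, add_zero]; exact measureReal_nonneg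
    · have key := star_lsp_of_dominatedRelay u A S' x r c j hrA hrS' (by rw [hxq]; exact hqr) (by rw [hxq]; exact hDq r hrD)
      exact key
  · -- #### a star missing `D`: the reference is the sub-champion `p`
    have hxp : x = p := by simp only [hx, href]; rw [if_neg hmeet]
    by_cases hpS : x ∈ S'
    · have h1 : ν.real {ξ | (∀ m ∈ S', ¬ (openGraph ξ).Reachable x m) ∧ 1 ≤ MS ξ ∧ MS ξ ≤ j} = 0 := by
        have : {ξ | (∀ m ∈ S', ¬ (openGraph ξ).Reachable x m) ∧ 1 ≤ MS ξ ∧ MS ξ ≤ j} = (∅ : Set (BondConfig (Fin n))) := by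
          ext ξ; simp only [mem_setOf_eq, mem_empty_iff_false, iff_false, not_and]
          intro h; exact absurd (SimpleGraph.Reachable.refl x) (h x hpS)
        rw [this, measureReal_empty]
      have h2 : ν.real {ξ | ¬ 1 ≤ MS ξ ∧ Lx c ξ ≤ j} = 0 := by
        have : {ξ | ¬ 1 ≤ MS ξ ∧ Lx c ξ ≤ j} = (∅ : Set (BondConfig (Fin n))) := by
          ext ξ; simp only [mem_setOf_eq, mem_empty_iff_false, iff_false, not_and]
          intro h; exact absurd (SimpleGraph.Reachable.refl x) (hMS0 ξ h x hpS)
        rw [this, measureReal_empty]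
      rw [h1, h2, add_zero]; exact measureReal_nonneg
    by_cases hdm : ∃ m ∈ S', sW m ≤ sW x
    · -- a member no `u`-lighter than `p`: unguarded stability
      obtain ⟨m, hmS, hm⟩ := hdm
      have hxm : x ≠ m := fun h => hpS (h ▸ hmS)
      have key := unguardedStability_of_member u A S' hmS hxm j hm
      change ν.real {ξ | (∀ m ∈ S', ¬ (openGraph ξ).Reachable x m) ∧ MS ξ ≤ j} ≤
        ν.real {ξ | (∀ m ∈ S', ¬ (openGraph ξ).Reachable x m) ∧ Lx x ξ ≤ j} at key
      have hdisj : Disjoint {ξ | (∀ m ∈ S', ¬ (openGraph ξ).Reachable x m) ∧ 1 ≤ MS ξ ∧ MS ξ ≤ j} {ξ | ¬ 1 ≤ MS ξ ∧ Lx c ξ ≤ j} := by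
        rw [Set.disjoint_left]
        rintro ξ ⟨_, h1, _⟩ ⟨h2, _⟩
        exact h2 h1
      have hsub : {ξ | (∀ m ∈ S', ¬ (openGraph ξ).Reachable x m) ∧ 1 ≤ MS ξ ∧ MS ξ ≤ j} ∪ {ξ | ¬ 1 ≤ MS ξ ∧ Lx c ξ ≤ j} ⊆
          {ξ | (∀ m ∈ S', ¬ (openGraph ξ).Reachable x m) ∧ MS ξ ≤ j} := by
        rintro ξ (⟨h1, _, h3⟩ | ⟨h1, _⟩)
        · exact ⟨h1, h3⟩
        · exact ⟨hMS0 ξ h1, by show MS ξ ≤ j; omega⟩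
      have hu' := measureReal_union hdisj (MeasurableSet.of_discrete (s := {ξ | ¬ 1 ≤ MS ξ ∧ Lx c ξ ≤ j})) (μ := ν)
        (measure_ne_top _ _) (measure_ne_top _ _)
      rw [← hu']
      exact (measureReal_mono hsub (measure_ne_top _ _)).trans key
    · -- all members non-relays `u`-lighter than `p`: the induction hypothesis in `u`
      push Not at hdm
      have hS'A : ∀ m ∈ S', m ∉ A := by
        intro m hm hmA
        have := hpmax m hmA
        rw [← hxp] at this
        exact absurd this (not_le.2 (hdm m hm))
      have hS'ne : S'.Nonempty := by
        obtain ⟨m, hm⟩ := hB'ne; exact ⟨m, Finset.mem_union_left _ hm⟩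
      have hpch' : ∀ a ∈ A, ν.real {ξ : BondConfig (Fin n) | (A.filter fun z => ξ ∈ openConn a z).card ≤ j} ≤
          ν.real {ξ : BondConfig (Fin n) | (A.filter fun z => ξ ∈ openConn x z).card ≤ j} := by rw [hxp]; exact hpch
      have hIH := ih n u A S' x c j hlt hxA hcA hS'ne hS'A hpch'
      have hfiltS : ∀ (ξ : BondConfig (Fin n)),
          (A.filter fun z => ∃ m ∈ S', (openGraph ξ).Reachable m z) = (A.filter fun z => ∃ m ∈ S', ξ ∈ openConn m z) :=
        fun ξ => Finset.filter_congr fun _ _ => Iff.rfl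
      have eL : {ξ : BondConfig (Fin n) | (∀ m ∈ S', ξ ∉ openConn x m) ∧ 1 ≤ (A.filter fun z => ∃ m ∈ S', ξ ∈ openConn m z).card ∧
            (A.filter fun z => ∃ m ∈ S', ξ ∈ openConn m z).card ≤ j} = {ξ | (∀ m ∈ S', ¬ (openGraph ξ).Reachable x m) ∧ 1 ≤ MS ξ ∧ MS ξ ≤ j} := by
        ext ξ; simp only [mem_setOf_eq, hMS, hfiltS ξ]; exact Iff.rfl
      have eZ : {ξ : BondConfig (Fin n) | ¬ 1 ≤ (A.filter fun z => ∃ m ∈ S', ξ ∈ openConn m z).card ∧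
            (A.filter fun z => ξ ∈ openConn c z).card ≤ j} = {ξ | ¬ 1 ≤ MS ξ ∧ Lx c ξ ≤ j} := by
        ext ξ; simp only [mem_setOf_eq, hMS, hLx, hfiltS ξ, hfilt c ξ]
      have eR : {ξ : BondConfig (Fin n) | (∀ m ∈ S', ξ ∉ openConn x m) ∧ (A.filter fun z => ξ ∈ openConn x z).card ≤ j} =
          {ξ | (∀ m ∈ S', ¬ (openGraph ξ).Reachable x m) ∧ Lx x ξ ≤ j} := by
        ext ξ; simp only [mem_setOf_eq, hLx, hfilt x ξ]; exact Iff.rfl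
      rw [eL, eZ, eR] at hIH
      exact hIH

end Summit.CriticalPhenomena.PercolationContinuityZ3.Theorems

end
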